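import Literature.NumberTheory.Automorphic.ReciprocityGLnProofs
import Literature.NumberTheory.GaloisRepresentations.AbsGaloisGroup
import HarnessLib

/-!
# Caraiani–Le Hung 2016, Thm. 1.1: the image of complex conjugation in the Galois representations
# attached to regular algebraic cuspidal automorphic representations of `GL_n` over totally real fields

Topic `NumberTheory/Automorphic` (vocabulary of `ReciprocityGLn` / `ReciprocityGLnProofs`:
`CuspidalAutomorphicRepData`, `AutomorphicRepData.IsRegularAlgebraic`,
`HarrisLanTaylorThorne2016.IsCompatible`; of `GaloisRepresentations/AbsGaloisGroup`:
`IsComplexConjugation φ c` for a real embedding `φ : F →+* ℝ`).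

Named fact vendored by a grounder for route `Langlands/Langlands/NonParallelVoid`: it is the "sign
theorem" consumed by the crux `Summit.Langlands.Langlands.Theses.NonParallelVoid.TensorSquareParallel`
(stmt-Langlands-17009; plan: the tensor induction `ψ` of a non-parallel `ρ` would be potentially
automorphic over a totally real field, where this theorem forces `tr ψ(c) = 0` for `n = 4`, whereas
`tr ψ(c) = ±2` — Calegari 2010, Lemma 2.1).

## Source (A. Caraiani, B. V. Le Hung, *On the image of complex conjugation in certain Galois
representations*, Compositio Math. **152** (2016) 1476–1488 = arXiv:1409.2158 [cite: CaraianiLehung2016];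
verbatim from §1 of the held arXiv text, p. 1)

"Let `F` be a totally real field and let `π` be a cuspidal automorphic representation of
`GL_n(𝔸_F)` such that `π_∞` is regular `L`-algebraic. Let `S` be a finite set of places of `F`,
which contains all the places where `π` is ramified […]. Then there exists a Galois representation
`σ_π : G_{F,S} → GL_n(ℚ̄_p)` which satisfies local-global compatibility at all finite places
`v ∉ S`. More precisely, for every finite place `v ∉ S`, the Satake parameters of `π_v` are the same
as the eigenvalues of `σ_π(Frob_v)` (see, for example, Corollary V.4.2 of [Scholze, torsion]). We
prove the following

**Theorem 1.1.** Let `π` be a regular `L`-algebraic, cuspidal automorphic representation of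
`GL_n(𝔸_F)`, with associated (`p`-adic) Galois representation `σ_π`. Let `c ∈ Gal(F̄/F)` be a
choice of complex conjugation. Then `tr(σ_π)(c) = 0` if `n` is even and `tr(σ_π)(c) = ±1` if `n` is
odd."

Printed caveat (§1, first paragraph): "Our results are conditional on Arthur's work [Arthur, *The
endoscopic classification of representations*]" — i.e. on the stabilisation of the twisted trace
formula, since established (Mœglin–Waldspurger 2016); the same dependence is carried by the tree's
`HarrisLanTaylorThorne2016.theoremA_existence` / Scholze-type facts, so it is recorded here and not
modelled.

## Rendering

* **Normalisation.** The tree attaches Galois representations to regular *C*-algebraic (Clozel: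
  "regular algebraic", `AutomorphicRepData.IsRegularAlgebraic`) cuspidal `Π` through
  `HarrisLanTaylorThorne2016.IsCompatible Π ι r`: at unramified places the characteristic polynomial
  of `r(Frob_v)` is that of `ι⁻¹ rec(Π_v ⊗ |det|_v^{(1-n)/2})`. For such `Π` the twist
  `π := Π ⊗ |det|^{(1-n)/2}` is regular `L`-algebraic and cuspidal, and by the displayed
  characterisation `σ_π` IS the representation `r` compatible with `Π` (same Frobenius eigenvalues
  at almost all places; `r` semisimple, so unique up to isomorphism by Chebotarev and
  Brauer–Nesbitt — the rendering used by the accepted `Qian2022.IsAutomorphic`). Conversely every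
  regular `L`-algebraic cuspidal `π` is `Π ⊗ |det|^{(1-n)/2}` for the regular `C`-algebraic
  `Π = π ⊗ |det|^{(n-1)/2}`. Hence the theorem is stated, equivalently, for every regular algebraic
  cuspidal `Π` (typed by the compactness fact `hcpt`, as in `ReciprocityGLn`) and every SEMISIMPLE
  `r : Γ_F → GL_n(ℚ̄_p)` that is HLTT-compatible with `Π` for some `ι : ℚ̄_p ≃ ℂ`.
* "a choice of complex conjugation `c ∈ Gal(F̄/F)`": an element `c` of `absoluteGaloisGroup F` that
  is a complex conjugation for some real embedding `φ : F →+* ℝ` (`IsComplexConjugation φ c`); `F`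
  totally real is Mathlib's `IsTotallyReal F`.
* Conclusion on the trace of the matrix `r c ∈ GL_n(ℚ̄_p)`: `= 0` for `n` even, `= 1 ∨ = -1` for
  `n` odd. Users take `(h : CaraianiLeHung2016_thm_1_1)`.

Deliberately NOT here: the torsion version (Thm. 1.2 / determinants of Scholze's Hecke algebras),
the essentially self-dual predecessors (Taylor 2012, Taïbi 2016), and any statement over CM fields.
-/

noncomputable section

open scoped MatrixGroups NumberField
open NumberField IsDedekindDomain Field
open Literature.NumberTheory.GaloisRepresentations

namespace Literature.NumberTheory.Automorphic

/-- **Caraiani–Le Hung 2016, Theorem 1.1** (image of complex conjugation). *Let `F` be totally real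
and `π` a regular `L`-algebraic cuspidal automorphic representation of `GL_n(𝔸_F)` with associated
`p`-adic Galois representation `σ_π`; let `c ∈ Gal(F̄/F)` be a complex conjugation. Then
`tr σ_π(c) = 0` if `n` is even and `tr σ_π(c) = ±1` if `n` is odd.*  Rendered (see the module
docstring for the `L`/`C` twist) for a regular algebraic cuspidal `Π` of `GL_n(𝔸_F)` and a
semisimple `r : Γ_F → GL_n(ℚ̄_p)` that is HLTT-compatible with `Π` (`r ≅ r_{p,ι}(Π) = σ_π`,
`π = Π ⊗ |det|^{(1-n)/2}`). Grounds the sign step of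
`Summit.Langlands.Langlands.Theses.NonParallelVoid.TensorSquareParallel` (stmt-Langlands-17009).
Printed as conditional on Arthur's endoscopic classification. [cite: CaraianiLehung2016, Thm 1.1] -/
def CaraianiLeHung2016_thm_1_1 : Prop :=
  ∀ (F : Type) [Field F] [NumberField F], IsTotallyReal F →
  ∀ (n : ℕ) (hcpt : isCompact_glFiniteIntegralLevel n F) (π : CuspidalAutomorphicRepData n F hcpt),
    π.1.IsRegularAlgebraic →
  ∀ (p : ℕ) [Fact p.Prime] (ι : PadicAlgCl p ≃+* ℂ) (r : FramedGaloisRep F (PadicAlgCl p) n),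
    r.toGaloisRep.IsSemisimple → HarrisLanTaylorThorne2016.IsCompatible π.1 ι r →
  ∀ (φ : F →+* ℝ) (c : absoluteGaloisGroup F), IsComplexConjugation φ c →
    (Even n → Matrix.trace ((r c : GL (Fin n) (PadicAlgCl p)) : Matrix (Fin n) (Fin n) (PadicAlgCl p)) = 0) ∧
    (Odd n →
      Matrix.trace ((r c : GL (Fin n) (PadicAlgCl p)) : Matrix (Fin n) (Fin n) (PadicAlgCl p)) = 1 ∨
      Matrix.trace ((r c : GL (Fin n) (PadicAlgCl p)) : Matrix (Fin n) (Fin n) (PadicAlgCl p)) = -1)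

end Literature.NumberTheory.Automorphic
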